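import Summits.BirchSwinnertonDyer.BirchSwinnertonDyer.Theorems.ByReductionTypeAtTwoFineSelmerConjAAtTwoAdditivePotGoodClassNumberOne780
import Summits.BirchSwinnertonDyer.BirchSwinnertonDyer.Theorems.ByReductionTypeAtTwoFineSelmerConjAAtTwoAdditivePotGoodPresentationDoor
import HarnessLib

/-!
# Route `ByReductionTypeAtTwo` (rung K4), crux C1″ `FineSelmerConjAAtTwoAdditivePotGood` (item stmt-BirchSwinnertonDyer-22615):
# CLASS NUMBER ONE FOR THE TOTALLY REAL CUBIC FIELD OF DISCRIMINANT `1257` (`X³ − X² − 14X − 15`) BY AN EXPLICIT MINKOWSKI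
# CERTIFICATE (KERNEL), hence Iwasawa's `μ₂ = 0` for it UNCONDITIONALLY — the `2`-torsion field of the census row `100560c1`
# (a `--supports 22615` file; seat `bsd-2adic-k4-w1` GEN 4; second consumer of `…ExplicitMinkowski`)

HONEST FRAMING (cell `bsd-2adic`, D-0036/D-0054): UNCONDITIONAL kernel theorems; closes nothing at the `∀`-level; nothing booked;
BSD is not proved by any of this.

THE CERTIFICATE. `g = X³ − X² − 14X − 15`, `disc g = 1257`, `2` INERT (`g` has odd constant term and odd `p + q`), `|d_K| ≤ 1257`,
`M_K ≤ (4/3.14)(6/27)√1257 < 11` (the true bound is `(6/27)√1257 < 8` since the field is totally real, but `r₂` is not computed here).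
Every prime ideal `I` with `N(I) ≤ 10` is principal:
* `N(I) ∈ {2, 4}` impossible and `N(I) = 8 ⟹ I = (2)`: a prime containing `2` has norm `≥ 8` (`…InertDoor`).
* `N(I) = 3`: `θ ≡ a ∈ {0, 2}`: `α = −3 − 2θ` resp. `α = −1 − θ`, norms `3, −3`.  `N(I) = 9`: `3 ∈ I` and `g ≡ X(X + 1)² (mod 3)`
  force `θ ∈ I` or `θ + 1 ∈ I`, whence an element of norm `±3` in `I` — impossible.
* `N(I) = 5`: `θ ≡ 0`: `α = θ² − 5`, norm `−5`.  * `N(I) = 7`: no root mod `7`.  * `N(I) ∈ {6, 10}`: impossible.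

* §1 `irreducible_cubic_disc_1257`, **`classNumber_eq_one_of_root_disc_1257`** (any cubic field containing a root of `g`).
* §2 `card_classGroup_adjoin_eq_one_disc_1257`; **`classicalMuVanishes_cubicField_disc_1257`**: `μ₂ = 0` along EVERY
  `ℤ₂`-extension of `ℚ(θ)`, `θ³ = θ² + 14θ + 15` — UNCONDITIONAL (the first TOTALLY REAL `S₃`-cubic instance in the tree).

References: [Marcus1977] Ch. 5, Thm. 35–37; [Cohen1993] §6.3, App. B (totally real cubic fields: d = 1257, h = 1);
[Greenberg2001IwasawaPastPresent] Prop. 2.1.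
-/

set_option autoImplicit false
-- sibling precedent (`…ClassNumberOne780.lean`): the directory name repeats the summit name
set_option linter.dupNamespace false

noncomputable section

open scoped Classical IntermediateField NumberField Real nonZeroDivisors

namespace Summit.BirchSwinnertonDyer.BirchSwinnertonDyer.Theorems.AddKatoTwo

open Polynomial IsDedekindDomain NumberField Matrix Literature.NumberTheory.EllipticCurves Literature.NumberTheory.IwasawaTheory

/-! ## §1 The certificate: `h = 1` -/

/-- `X³ − X² − 14X − 15` is irreducible over `ℚ` (odd constant term, odd `p + q`: no root mod `2`). -/
theorem irreducible_cubic_disc_1257 : Irreducible (Cubic.toPoly ⟨1, ((-1 : ℤ) : ℚ), ((-14 : ℤ) : ℚ), ((-15 : ℤ) : ℚ)⟩) :=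
  irreducible_cubic_of_odd (by decide) (by decide)

section Certificate

variable (K : Type) [Field K] [NumberField K]

/-- The companion-determinant norms of the generators `−3 − 2θ`, `−1 − θ`, `θ² − 5` of the field of `X³ − X² − 14X − 15`:
`3, −3, −5`. -/
private theorem dets_disc_1257 :
    (((-3 : ℤ) : ℚ) • (1 : Matrix (Fin 3) (Fin 3) ℚ) + ((-2 : ℤ) : ℚ) • !![(0 : ℚ), 0, -(-15 : ℤ); 1, 0, -(-14 : ℤ); 0, 1, -(-1 : ℤ)] +
        ((0 : ℤ) : ℚ) • !![(0 : ℚ), 0, -(-15 : ℤ); 1, 0, -(-14 : ℤ); 0, 1, -(-1 : ℤ)] ^ 2).det = 3 ∧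
    (((-1 : ℤ) : ℚ) • (1 : Matrix (Fin 3) (Fin 3) ℚ) + ((-1 : ℤ) : ℚ) • !![(0 : ℚ), 0, -(-15 : ℤ); 1, 0, -(-14 : ℤ); 0, 1, -(-1 : ℤ)] +
        ((0 : ℤ) : ℚ) • !![(0 : ℚ), 0, -(-15 : ℤ); 1, 0, -(-14 : ℤ); 0, 1, -(-1 : ℤ)] ^ 2).det = -3 ∧
    (((-5 : ℤ) : ℚ) • (1 : Matrix (Fin 3) (Fin 3) ℚ) + ((0 : ℤ) : ℚ) • !![(0 : ℚ), 0, -(-15 : ℤ); 1, 0, -(-14 : ℤ); 0, 1, -(-1 : ℤ)] +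
        ((1 : ℤ) : ℚ) • !![(0 : ℚ), 0, -(-15 : ℤ); 1, 0, -(-14 : ℤ); 0, 1, -(-1 : ℤ)] ^ 2).det = -5 := by
  refine ⟨?_, ?_, ?_⟩ <;>
  · simp [Matrix.det_fin_three, sq]
    norm_num

/-- **`h = 1` for every cubic number field containing a root `θ` of `X³ − X² − 14X − 15`** (the field of discriminant `1257`), by the
explicit Minkowski certificate of the module docstring. KERNEL. [cite: Marcus1977, Ch. 5 Thm. 37 and Cor. 2]
[cite: Cohen1993, App. B (totally real cubic fields: d = 1257, h = 1)] -/
theorem classNumber_eq_one_of_root_disc_1257 (h3 : Module.finrank ℚ K = 3) (b : 𝓞 K)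
    (hb : b ^ 3 + (-1 : ℤ) * b ^ 2 + (-14 : ℤ) * b + (-15 : ℤ) = 0) : NumberField.classNumber K = 1 := by
  have hirr := irreducible_cubic_disc_1257
  have hd : |NumberField.discr K| ≤ (1257 : ℕ) :=
    (abs_discr_le_abs_cubic_discr K h3 b hirr hb).trans (by simp only [Cubic.discr]; norm_num)
  have hM := minkowskiBound_lt_of_sqrt_le K h3 hd (s := 35.46) (B := 11)
    ((Real.sqrt_le_sqrt (by norm_num : ((1257 : ℕ) : ℝ) ≤ (35.46 : ℝ) ^ 2)).trans (Real.sqrt_sq (by norm_num)).le)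
    (by norm_num)
  obtain ⟨hN3a, hN3b, hN5⟩ := dets_disc_1257
  have hb' : b ^ 3 - b ^ 2 - 14 * b - 15 = 0 := by push_cast at hb; linear_combination hb
  rw [NumberField.classNumber_eq_one_iff]
  refine RingOfIntegers.isPrincipalIdealRing_of_isPrincipal_of_norm_le_of_isPrime fun I hI hle ↦ ?_
  have hlt : Ideal.absNorm (I : Ideal (𝓞 K)) < 11 := by exact_mod_cast hle.trans_lt hM
  have h0 : Ideal.absNorm (I : Ideal (𝓞 K)) ≠ 0 := Ideal.absNorm_ne_zero_of_nonZeroDivisors I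
  have h1 : Ideal.absNorm (I : Ideal (𝓞 K)) ≠ 1 := by rw [Ne, Ideal.absNorm_eq_one_iff]; exact hI.ne_top
  have hmemN := Ideal.absNorm_mem (I : Ideal (𝓞 K))
  have nα3a := natAbs_norm_coords_eq K h3 b hirr hb (-3) (-2) 0 (n := 3) hN3a (by norm_num)
  have nα3b := natAbs_norm_coords_eq K h3 b hirr hb (-1) (-1) 0 (n := 3) hN3b (by norm_num)
  have nα5 := natAbs_norm_coords_eq K h3 b hirr hb (-5) 0 1 (n := 5) hN5 (by norm_num)
  -- `2 ∈ I ⟹ 8 ≤ N(I)` (2 is inert)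
  have key2 : ((2 : ℕ) : 𝓞 K) ∈ (I : Ideal (𝓞 K)) → 8 ≤ Ideal.absNorm (I : Ideal (𝓞 K)) := fun h2 =>
    eight_le_absNorm_of_cubic_root K ⟨I, hI, nonZeroDivisors.coe_ne_zero I⟩ h2 b (p := -1) (q := -14) (r := -15)
      (by decide) (by decide) hb
  -- `2 ∈ I ⟹ N(I) ∣ 8`, `3 ∈ I ⟹ N(I) ∣ 27`, `5 ∈ I ⟹ N(I) ∣ 125`
  have hdv2 : ((2 : ℕ) : 𝓞 K) ∈ (I : Ideal (𝓞 K)) → Ideal.absNorm (I : Ideal (𝓞 K)) ∣ 2 ^ 3 :=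
    fun h => absNorm_dvd_pow_three_of_natCast_mem K h3 h
  have hdv3 : ((3 : ℕ) : 𝓞 K) ∈ (I : Ideal (𝓞 K)) → Ideal.absNorm (I : Ideal (𝓞 K)) ∣ 3 ^ 3 :=
    fun h => absNorm_dvd_pow_three_of_natCast_mem K h3 h
  have hdv5 : ((5 : ℕ) : 𝓞 K) ∈ (I : Ideal (𝓞 K)) → Ideal.absNorm (I : Ideal (𝓞 K)) ∣ 5 ^ 3 :=
    fun h => absNorm_dvd_pow_three_of_natCast_mem K h3 h
  -- the two generators above `3`, as members of `I` once `θ ≡ 0` resp. `θ ≡ -1`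
  have gen3a : b ∈ (I : Ideal (𝓞 K)) → ((3 : ℕ) : 𝓞 K) ∈ (I : Ideal (𝓞 K)) → (((-3 : ℤ) : 𝓞 K) + ((-2 : ℤ) : 𝓞 K) * b + ((0 : ℤ) : 𝓞 K) * b ^ 2) ∈ (I : Ideal (𝓞 K)) := by
    intro hb0 h3m
    have : (((-3 : ℤ) : 𝓞 K) + ((-2 : ℤ) : 𝓞 K) * b + ((0 : ℤ) : 𝓞 K) * b ^ 2) = b * (-2) + ((3 : ℕ) : 𝓞 K) * (-1) := by
      push_cast; ring
    rw [this]; exact Ideal.add_mem _ (Ideal.mul_mem_right _ _ hb0) (Ideal.mul_mem_right _ _ h3m)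
  have gen3b : b + 1 ∈ (I : Ideal (𝓞 K)) → (((-1 : ℤ) : 𝓞 K) + ((-1 : ℤ) : 𝓞 K) * b + ((0 : ℤ) : 𝓞 K) * b ^ 2) ∈ (I : Ideal (𝓞 K)) := by
    intro hb1
    have : (((-1 : ℤ) : 𝓞 K) + ((-1 : ℤ) : 𝓞 K) * b + ((0 : ℤ) : 𝓞 K) * b ^ 2) = (b + 1) * (-1) := by push_cast; ring
    rw [this]; exact Ideal.mul_mem_right _ _ hb1
  have h2le : 2 ≤ Ideal.absNorm (I : Ideal (𝓞 K)) := by omega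
  interval_cases hn : Ideal.absNorm (I : Ideal (𝓞 K))
  · -- 2: inert
    exfalso; have := key2 (hmemN); omega
  · -- 3
    have h3m : ((3 : ℕ) : 𝓞 K) ∈ (I : Ideal (𝓞 K)) := hmemN
    obtain ⟨a, ha, hab⟩ := exists_sub_natCast_mem_of_absNorm_eq_prime K (by norm_num) hn b
    have hdvd := natCast_dvd_of_sub_mem K (by norm_num) hn h3 hb hab
    interval_cases a
    · exact ⟨⟨_, eq_span_singleton_of_mem_of_absNorm_eq K (by norm_num) hn (gen3a (by simpa using hab) h3m) nα3a⟩⟩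
    · norm_num at hdvd
    · refine ⟨⟨_, eq_span_singleton_of_mem_of_absNorm_eq K (by norm_num) hn (gen3b ?_) nα3b⟩⟩
      have : b + 1 = (b - ((2 : ℕ) : 𝓞 K)) + ((3 : ℕ) : 𝓞 K) := by push_cast; ring
      rw [this]; exact Ideal.add_mem _ hab h3m
  · -- 4
    exfalso
    have h4 : ((4 : ℕ) : 𝓞 K) ∈ (I : Ideal (𝓞 K)) := hmemN
    have h2 : ((2 : ℕ) : 𝓞 K) ∈ (I : Ideal (𝓞 K)) := by
      have : ((4 : ℕ) : 𝓞 K) = ((2 : ℕ) : 𝓞 K) * ((2 : ℕ) : 𝓞 K) := by push_cast; norm_num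
      rw [this] at h4; exact (hI.mem_or_mem h4).elim id id
    have := key2 h2; omega
  · -- 5
    have h5m : ((5 : ℕ) : 𝓞 K) ∈ (I : Ideal (𝓞 K)) := hmemN
    obtain ⟨a, ha, hab⟩ := exists_sub_natCast_mem_of_absNorm_eq_prime K (by norm_num) hn b
    have hdvd := natCast_dvd_of_sub_mem K (by norm_num) hn h3 hb hab
    interval_cases a
    · refine ⟨⟨_, eq_span_singleton_of_mem_of_absNorm_eq K (by norm_num) hn ?_ nα5⟩⟩
      have : (((-5 : ℤ) : 𝓞 K) + ((0 : ℤ) : 𝓞 K) * b + ((1 : ℤ) : 𝓞 K) * b ^ 2) = (b - ((0 : ℕ) : 𝓞 K)) * b + ((5 : ℕ) : 𝓞 K) * (-1) := by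
        push_cast; ring
      rw [this]; exact Ideal.add_mem _ (Ideal.mul_mem_right _ _ hab) (Ideal.mul_mem_right _ _ h5m)
    all_goals norm_num at hdvd
  · -- 6
    exfalso
    have h6 : ((6 : ℕ) : 𝓞 K) ∈ (I : Ideal (𝓞 K)) := hmemN
    have : ((6 : ℕ) : 𝓞 K) = ((2 : ℕ) : 𝓞 K) * ((3 : ℕ) : 𝓞 K) := by push_cast; norm_num
    rw [this] at h6
    rcases hI.mem_or_mem h6 with h | h
    · have := hdv2 h; norm_num at this
    · have := hdv3 h; norm_num at this
  · -- 7: no root mod 7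
    exfalso
    obtain ⟨a, ha, hab⟩ := exists_sub_natCast_mem_of_absNorm_eq_prime K (by norm_num) hn b
    have hdvd := natCast_dvd_of_sub_mem K (by norm_num) hn h3 hb hab
    interval_cases a <;> norm_num at hdvd
  · -- 8: `I = (2)`
    have h8 : ((8 : ℕ) : 𝓞 K) ∈ (I : Ideal (𝓞 K)) := hmemN
    have h2 : ((2 : ℕ) : 𝓞 K) ∈ (I : Ideal (𝓞 K)) := by
      apply hI.mem_of_pow_mem 3
      have : ((2 : ℕ) : 𝓞 K) ^ 3 = ((8 : ℕ) : 𝓞 K) := by push_cast; norm_num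
      rwa [this]
    have hN2 : (Algebra.norm ℤ ((2 : ℕ) : 𝓞 K)).natAbs = 8 := by
      have : ((2 : ℕ) : 𝓞 K) = algebraMap ℤ (𝓞 K) 2 := by simp
      rw [this, Algebra.norm_algebraMap, NumberField.RingOfIntegers.rank, h3]; norm_num
    exact ⟨⟨_, eq_span_singleton_of_mem_of_absNorm_eq K (by norm_num) hn h2 hN2⟩⟩
  · -- 9: `3 ∈ I`, `θ(θ+1)² ∈ (3)`
    exfalso
    have h9 : ((9 : ℕ) : 𝓞 K) ∈ (I : Ideal (𝓞 K)) := hmemN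
    have h3m : ((3 : ℕ) : 𝓞 K) ∈ (I : Ideal (𝓞 K)) := by
      apply hI.mem_of_pow_mem 2
      have : ((3 : ℕ) : 𝓞 K) ^ 2 = ((9 : ℕ) : 𝓞 K) := by push_cast; norm_num
      rwa [this]
    have hprod : b * (b + 1) ^ 2 ∈ (I : Ideal (𝓞 K)) := by
      have : b * (b + 1) ^ 2 = ((3 : ℕ) : 𝓞 K) * (b ^ 2 + 5 * b + 5) := by push_cast; linear_combination hb'
      rw [this]; exact Ideal.mul_mem_right _ _ h3m
    rcases hI.mem_or_mem hprod with h | h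
    · have hdvd := Ideal.absNorm_dvd_absNorm_of_le ((Ideal.span_singleton_le_iff_mem _).mpr (gen3a h h3m))
      rw [Ideal.absNorm_span_singleton, nα3a, hn] at hdvd; omega
    · have hdvd := Ideal.absNorm_dvd_absNorm_of_le
        ((Ideal.span_singleton_le_iff_mem _).mpr (gen3b (hI.mem_of_pow_mem 2 h)))
      rw [Ideal.absNorm_span_singleton, nα3b, hn] at hdvd; omega
  · -- 10
    exfalso
    have h10 : ((10 : ℕ) : 𝓞 K) ∈ (I : Ideal (𝓞 K)) := hmemN
    have : ((10 : ℕ) : 𝓞 K) = ((2 : ℕ) : 𝓞 K) * ((5 : ℕ) : 𝓞 K) := by push_cast; norm_num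
    rw [this] at h10
    rcases hI.mem_or_mem h10 with h | h
    · have := hdv2 h; norm_num at this
    · have := hdv5 h; norm_num at this

end Certificate

/-! ## §2 `ℚ(θ)`: class number one and UNCONDITIONAL `μ₂ = 0` -/

section Adjoin

/-- `#Cl(𝓞 ℚ(θ)) = 1` for every root `θ` of `X³ − X² − 14X − 15`. KERNEL. [cite: Cohen1993, App. B (d = 1257)] -/
theorem card_classGroup_adjoin_eq_one_disc_1257 {θ : AlgebraicClosure ℚ}
    (hθ : aeval θ (Cubic.toPoly ⟨1, ((-1 : ℤ) : ℚ), ((-14 : ℤ) : ℚ), ((-15 : ℤ) : ℚ)⟩) = 0) :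
    Nat.card (ClassGroup (𝓞 (IntermediateField.adjoin ℚ {θ}))) = 1 := by
  have hfm : (Cubic.toPoly ⟨1, ((-1 : ℤ) : ℚ), ((-14 : ℤ) : ℚ), ((-15 : ℤ) : ℚ)⟩).Monic := Cubic.monic_of_a_eq_one'
  have hθint : IsIntegral ℚ θ := ⟨_, hfm, by rwa [← aeval_def]⟩
  haveI : FiniteDimensional ℚ (IntermediateField.adjoin ℚ {θ}) := IntermediateField.adjoin.finiteDimensional hθint
  haveI : NumberField (IntermediateField.adjoin ℚ {θ}) := NumberField.mk
  obtain ⟨b, -, hb⟩ := exists_ringOfIntegers_cubic_root (p := -1) (q := -14) (r := -15) hθ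
  have h1 := classNumber_eq_one_of_root_disc_1257 _
    (finrank_adjoin_eq_three_of_irreducible irreducible_cubic_disc_1257 hθ) b hb
  rw [NumberField.classNumber, ← Nat.card_eq_fintype_card] at h1
  exact h1

/-- **Iwasawa's `μ₂ = 0` for the totally real cubic field of discriminant `1257`** (`ℚ(θ)`, `θ³ = θ² + 14θ + 15`; `2` inert,
`h = 1` by §1): along EVERY `ℤ₂`-extension of `ℚ(θ)`, UNCONDITIONAL. [cite: Greenberg2001IwasawaPastPresent, Prop. 2.1 p. 339]
[cite: Cohen1993, App. B (d = 1257)] -/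
theorem classicalMuVanishes_cubicField_disc_1257 {θ : AlgebraicClosure ℚ}
    (hθ : aeval θ (Cubic.toPoly ⟨1, ((-1 : ℤ) : ℚ), ((-14 : ℤ) : ℚ), ((-15 : ℤ) : ℚ)⟩) = 0)
    (κ : ZpExtension (IntermediateField.adjoin ℚ {θ}) 2) : ClassicalMuVanishes κ :=
  classicalMuVanishes_two_adjoin_of_odd (p := -1) (q := -14) (r := -15) (by decide) (by decide) hθ
    (by rw [card_classGroup_adjoin_eq_one_disc_1257 hθ]; norm_num) κ

end Adjoin

end Summit.BirchSwinnertonDyer.BirchSwinnertonDyer.Theorems.AddKatoTwo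

end
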